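import Summits.Ventures.CertifiedQuantumChemistry.Rows.LevelShiftTempleRows
import Literature.Computation.Certificates.TempleMomentCertificate
import HarnessLib

/-!
# Ventures/CertifiedQuantumChemistry — Rows/TempleMomentRows.lean: Temple rows from INTERVAL
# (outward-rounded) SHIFTED MOMENTS of one explicit state — certnum's kernel-decidable
# `TempleMoments.Cert.check` + the enclosures ⇒ `TempleCertificate` ⇒ `LowerRow` / `Bracket`

HONEST FRAMING (verbatim): certified bounds for a stated model Hamiltonian in a stated basis; not a
claim about the real molecule or material beyond that model.

Typer chem-type-09 (LADDER-CHEM I-TYPE slot 09, cell chem-oracle; chem-lead A17 (3) 2026-08-27T01:04:36Z: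
«certnum-lean-1's p480539 TempleMomentCertificate (interval shifted moments ⇒ Temple hypotheses,
kernel-decidable `Cert.check`) NOTED as the L4 piece door M1's assembler consumes when moments are
enclosures, not rationals — chem-type-10 / chem-type-09: cite it by decl (no parallel file on our side;
type-09 stays sole writer of Rows/Temple*)»). COMPOSITION ONLY — nothing of certnum's file is restated:
`Literature.Computation.Certificates.TempleMoments.temple_hypotheses_of_check` (record `Cert
⟨ρ, β, lo, nlo, nhi, alo, ahi, bhi⟩`, `check = (0 < nlo) ∧ (ahi < gapLo) ∧ (bhi ≤ rhsLo)`) delivers word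
for word the body of chem-solver-6's `TempleCertificate F a b lo β` (`Rows/TempleLowerRow.lean`); this file
adds the model / sector / gap-leg plumbing so that an interval-MPS Temple row (RQ-011: block2 MPS `ψ`,
exact-or-enclosed `⟨ψ|ψ⟩`, `⟨ψ|(Ĥ−ρ)|ψ⟩`, `‖(Ĥ−ρ)ψ‖²`) has a ONE-DECL Lean cell.

## Contents (all `theorem`, no `def`)
* §1 `templeCertificate_of_momentCheck` — symmetric `F`, a vector `ψ` of the `(a, b)` sector, a passing
  record and the five enclosure inequalities of `ψ`'s shifted moments w.r.t. `Ĥ(F)` ⇒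
  `TempleCertificate F a b c.lo c.beta`.
* §2 LOWER rows: `lowerRow_of_momentCheck` (+ `GapCertificate F a b β` with `c.beta ≤ β`),
  `lowerRow_of_momentCheck_codimOne` (+ `GapCertificateCodimOne`), `lowerRow_of_levelShift_momentCheck_closedShell`
  (+ the closed-shell LEVEL-SHIFT leg `LowerRow (Model.lincomb 1 λ F (Model.diagWeight 1_J μ)) |J| |J| ℓ`
  with `c.beta ≤ ℓ − λ(2|J| − 1 − μ)` — the production chain of door M1).
* §3 UPPER row from the same enclosures: `upperRow_of_momentEnclosure` — `ahi ≤ min((hi−ρ)·nlo, (hi−ρ)·nhi)`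
  (decidable on the record) ⇒ `UpperRow F a b hi` (Rayleigh–Ritz; the interval-evaluation rule
  `TempleMoments.min_mul_mul_le_mul`); and the two-sided `bracket_of_momentCheck(_codimOne)`.

What is NOT here: how the enclosures are produced (certnum kernels), the gap leg (separate certificate),
any number or claim node. References as in the cited files: Weinstein–Stenger (1972) Ch. 5 §9 eq. (2)
[cite: WeinsteinStenger1972, Ch. 5 §9 eq. (2), p. 104]; Reed–Simon IV Thm XIII.5 [cite: ReedSimonIV1978, Thm XIII.5].
-/

noncomputable section

namespace Summit.Ventures.CertifiedQuantumChemistry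

open Matrix Finset
open Literature.MathematicalPhysics.QuantumLattice Literature.MathematicalPhysics.QuantumChemistry
open Literature.Computation.Certificates
open scoped ComplexOrder

variable {k : ℕ}

/-! ## §1 Interval shifted moments ⇒ the exact Temple certificate predicate -/

/-- **INTERVAL SHIFTED MOMENTS ⇒ `TempleCertificate`.** For a symmetric model `F`, a vector `ψ`
supported on the `(a, b)` sector, and a passing certnum record `c` (`c.check = true`) whose intervals
enclose `⟨ψ,ψ⟩ ∈ [nlo, nhi]`, `Re⟨ψ,(Ĥ(F) − ρ)ψ⟩ ∈ [alo, ahi]`, `‖(Ĥ(F) − ρ)ψ‖² ≤ bhi` (`ρ = c.rho`):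
`TempleCertificate F a b c.lo c.beta` (`Rows/TempleLowerRow.lean`) — by certnum's
`TempleMoments.temple_hypotheses_of_check`. [cite: WeinsteinStenger1972, Ch. 5 §9 eq. (2), p. 104] -/
theorem templeCertificate_of_momentCheck {F : Model k} (hF : F.IsSymmetric) {a b : ℕ}
    {c : TempleMoments.Cert} (hc : c.check = true) {ψ : Fock (Orb (Fin k))} (hψ : IsInSector a b ψ)
    (hnlo : (c.nlo : ℝ) ≤ (star ψ ⬝ᵥ ψ).re) (hnhi : (star ψ ⬝ᵥ ψ).re ≤ (c.nhi : ℝ))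
    (halo : (c.alo : ℝ) ≤ (star ψ ⬝ᵥ (F.hamiltonian *ᵥ ψ - ((c.rho : ℝ) : ℂ) • ψ)).re)
    (hahi : (star ψ ⬝ᵥ (F.hamiltonian *ᵥ ψ - ((c.rho : ℝ) : ℂ) • ψ)).re ≤ (c.ahi : ℝ))
    (hbhi : (star (F.hamiltonian *ᵥ ψ - ((c.rho : ℝ) : ℂ) • ψ) ⬝ᵥ
      (F.hamiltonian *ᵥ ψ - ((c.rho : ℝ) : ℂ) • ψ)).re ≤ (c.bhi : ℝ)) :
    TempleCertificate F a b c.lo c.beta := by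
  obtain ⟨h0, hlt, hle⟩ := TempleMoments.temple_hypotheses_of_check
    (Model.hamiltonian_isHermitian hF) hc hnlo hnhi halo hahi hbhi
  exact ⟨ψ, hψ, h0, hlt, hle⟩

/-! ## §2 Lower rows: moment check + a gap leg -/

/-- **TEMPLE LOWER ROW FROM INTERVAL MOMENTS + THE SPECTRAL GAP LEG**: as above plus
`GapCertificate F a b β` (`Rows/TempleLowerRow.lean`) for some rational `β ≥ c.beta` ⇒ `LowerRow F a b c.lo`
(`lowerRow_of_temple` after `GapCertificate.mono`). [cite: WeinsteinStenger1972, Ch. 5 §9 eq. (2), p. 104] -/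
theorem lowerRow_of_momentCheck {F : Model k} (hF : F.IsSymmetric) {a b : ℕ} {β : ℚ}
    (hG : GapCertificate F a b β) {c : TempleMoments.Cert} (hβ : c.beta ≤ β) (hc : c.check = true)
    {ψ : Fock (Orb (Fin k))} (hψ : IsInSector a b ψ)
    (hnlo : (c.nlo : ℝ) ≤ (star ψ ⬝ᵥ ψ).re) (hnhi : (star ψ ⬝ᵥ ψ).re ≤ (c.nhi : ℝ))
    (halo : (c.alo : ℝ) ≤ (star ψ ⬝ᵥ (F.hamiltonian *ᵥ ψ - ((c.rho : ℝ) : ℂ) • ψ)).re)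
    (hahi : (star ψ ⬝ᵥ (F.hamiltonian *ᵥ ψ - ((c.rho : ℝ) : ℂ) • ψ)).re ≤ (c.ahi : ℝ))
    (hbhi : (star (F.hamiltonian *ᵥ ψ - ((c.rho : ℝ) : ℂ) • ψ) ⬝ᵥ
      (F.hamiltonian *ᵥ ψ - ((c.rho : ℝ) : ℂ) • ψ)).re ≤ (c.bhi : ℝ)) :
    LowerRow F a b c.lo :=
  lowerRow_of_temple hF (hG.mono hβ) (templeCertificate_of_momentCheck hF hc hψ hnlo hnhi halo hahi hbhi)

/-- The same under the strong certificate `GapCertificateCodimOne F a b β` (`Rows/GapCertificateCodimOne.lean`;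
`λ₂(Ĥ(F)|sector) ≥ β` counting multiplicity). [cite: WeinsteinStenger1972, Ch. 5 §9 eq. (2), p. 104] -/
theorem lowerRow_of_momentCheck_codimOne {F : Model k} (hF : F.IsSymmetric) {a b : ℕ} {β : ℚ}
    (hG : GapCertificateCodimOne F a b β) {c : TempleMoments.Cert} (hβ : c.beta ≤ β)
    (hc : c.check = true) {ψ : Fock (Orb (Fin k))} (hψ : IsInSector a b ψ)
    (hnlo : (c.nlo : ℝ) ≤ (star ψ ⬝ᵥ ψ).re) (hnhi : (star ψ ⬝ᵥ ψ).re ≤ (c.nhi : ℝ))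
    (halo : (c.alo : ℝ) ≤ (star ψ ⬝ᵥ (F.hamiltonian *ᵥ ψ - ((c.rho : ℝ) : ℂ) • ψ)).re)
    (hahi : (star ψ ⬝ᵥ (F.hamiltonian *ᵥ ψ - ((c.rho : ℝ) : ℂ) • ψ)).re ≤ (c.ahi : ℝ))
    (hbhi : (star (F.hamiltonian *ᵥ ψ - ((c.rho : ℝ) : ℂ) • ψ) ⬝ᵥ
      (F.hamiltonian *ᵥ ψ - ((c.rho : ℝ) : ℂ) • ψ)).re ≤ (c.bhi : ℝ)) :
    LowerRow F a b c.lo :=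
  lowerRow_of_momentCheck hF (hG.gapCertificate hF) hβ hc hψ hnlo hnhi halo hahi hbhi

/-- **THE PRODUCTION CHAIN OF DOOR M1 IN ONE DECL** (interval-MPS witness): a symmetric model `F`,
the CLOSED-SHELL LEVEL-SHIFT leg `LowerRow (Model.lincomb 1 λ F (Model.diagWeight 1_J μ)) |J| |J| ℓ`
(`λ ≥ 0`; one FORMAT-qcl1 certificate on the shifted file, `Rows/LevelShiftGapRows.lean`), a certnum
record with `c.beta ≤ ℓ − λ(2|J| − 1 − μ)` passing `check`, and the enclosures of the shifted moments of
a `(|J|, |J|)`-sector vector `ψ` ⇒ `LowerRow F |J| |J| c.lo`.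
[cite: WeinsteinStenger1972, Ch. 5 §9 eq. (2), p. 104] -/
theorem lowerRow_of_levelShift_momentCheck_closedShell {F : Model k} (hF : F.IsSymmetric)
    {lam : ℚ} (hlam : 0 ≤ lam) (J : Finset (Fin k)) (μ : ℚ) {ℓ : ℚ}
    (hL : LowerRow (Model.lincomb 1 lam F
      (Model.diagWeight (fun p => if p ∈ J then (1 : ℚ) else 0) μ)) J.card J.card ℓ)
    {c : TempleMoments.Cert} (hβ : c.beta ≤ ℓ - lam * (2 * J.card - 1 - μ)) (hc : c.check = true)
    {ψ : Fock (Orb (Fin k))} (hψ : IsInSector J.card J.card ψ)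
    (hnlo : (c.nlo : ℝ) ≤ (star ψ ⬝ᵥ ψ).re) (hnhi : (star ψ ⬝ᵥ ψ).re ≤ (c.nhi : ℝ))
    (halo : (c.alo : ℝ) ≤ (star ψ ⬝ᵥ (F.hamiltonian *ᵥ ψ - ((c.rho : ℝ) : ℂ) • ψ)).re)
    (hahi : (star ψ ⬝ᵥ (F.hamiltonian *ᵥ ψ - ((c.rho : ℝ) : ℂ) • ψ)).re ≤ (c.ahi : ℝ))
    (hbhi : (star (F.hamiltonian *ᵥ ψ - ((c.rho : ℝ) : ℂ) • ψ) ⬝ᵥ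
      (F.hamiltonian *ᵥ ψ - ((c.rho : ℝ) : ℂ) • ψ)).re ≤ (c.bhi : ℝ)) :
    LowerRow F J.card J.card c.lo :=
  lowerRow_of_momentCheck hF (gapCertificate_of_lowerRow_closedShell hF hlam J μ hL) hβ hc hψ hnlo hnhi
    halo hahi hbhi

/-! ## §3 The upper row from the same enclosures, and the bracket -/

/-- **UPPER ROW FROM THE SHIFTED FIRST MOMENT ENCLOSURE** (Rayleigh–Ritz with the same witness): if
`0 < nlo ≤ ⟨ψ,ψ⟩ ≤ nhi`, `Re⟨ψ,(Ĥ(F) − ρ)ψ⟩ ≤ ahi` and the record-decidable side condition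
`ahi ≤ min((hi − ρ)·nlo, (hi − ρ)·nhi)` holds, then `Re⟨ψ,Ĥψ⟩ ≤ hi·⟨ψ,ψ⟩`, hence `UpperRow F a b hi`
(`upperRow_of_temple_witness`; interval-evaluation rule `TempleMoments.min_mul_mul_le_mul`).
[cite: WeinsteinStenger1972, Ch. 5 §9, p. 103] -/
theorem upperRow_of_momentEnclosure {F : Model k} (hF : F.IsSymmetric) {a b : ℕ}
    {ψ : Fock (Orb (Fin k))} (hψ : IsInSector a b ψ) {ρ nlo nhi ahi hi : ℚ} (h0 : 0 < nlo)
    (hnlo : (nlo : ℝ) ≤ (star ψ ⬝ᵥ ψ).re) (hnhi : (star ψ ⬝ᵥ ψ).re ≤ (nhi : ℝ))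
    (hahi : (star ψ ⬝ᵥ (F.hamiltonian *ᵥ ψ - ((ρ : ℝ) : ℂ) • ψ)).re ≤ (ahi : ℝ))
    (hside : ahi ≤ min ((hi - ρ) * nlo) ((hi - ρ) * nhi)) : UpperRow F a b hi := by
  have hψ0 : ψ ≠ 0 := by
    rintro rfl
    rw [dotProduct_zero, Complex.zero_re] at hnlo
    exact absurd (lt_of_lt_of_le (by exact_mod_cast h0 : (0 : ℝ) < nlo) hnlo) (lt_irrefl 0)
  refine upperRow_of_temple_witness hF hψ hψ0 ?_
  rw [TempleMoments.re_shifted_first_moment] at hahi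
  have hmin := TempleMoments.min_mul_mul_le_mul ((hi : ℝ) - ρ) hnlo hnhi
  have hside' : (ahi : ℝ) ≤ min (((hi : ℝ) - ρ) * nlo) (((hi : ℝ) - ρ) * nhi) := by exact_mod_cast hside
  have h := hahi.trans (hside'.trans hmin)
  linarith

/-- **TWO-SIDED TEMPLE BRACKET FROM ONE INTERVAL-MOMENT RECORD** (`GapCertificate` leg): lower side
`lowerRow_of_momentCheck`, upper side `upperRow_of_momentEnclosure` with the record's `(ρ, nlo, nhi, ahi)`.
[cite: WeinsteinStenger1972, Ch. 5 §9 eq. (2), p. 104] -/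
theorem bracket_of_momentCheck {F : Model k} (hF : F.IsSymmetric) {a b : ℕ} {β : ℚ}
    (hG : GapCertificate F a b β) {c : TempleMoments.Cert} (hβ : c.beta ≤ β) (hc : c.check = true)
    {hi : ℚ} (hside : c.ahi ≤ min ((hi - c.rho) * c.nlo) ((hi - c.rho) * c.nhi))
    {ψ : Fock (Orb (Fin k))} (hψ : IsInSector a b ψ)
    (hnlo : (c.nlo : ℝ) ≤ (star ψ ⬝ᵥ ψ).re) (hnhi : (star ψ ⬝ᵥ ψ).re ≤ (c.nhi : ℝ))
    (halo : (c.alo : ℝ) ≤ (star ψ ⬝ᵥ (F.hamiltonian *ᵥ ψ - ((c.rho : ℝ) : ℂ) • ψ)).re)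
    (hahi : (star ψ ⬝ᵥ (F.hamiltonian *ᵥ ψ - ((c.rho : ℝ) : ℂ) • ψ)).re ≤ (c.ahi : ℝ))
    (hbhi : (star (F.hamiltonian *ᵥ ψ - ((c.rho : ℝ) : ℂ) • ψ) ⬝ᵥ
      (F.hamiltonian *ᵥ ψ - ((c.rho : ℝ) : ℂ) • ψ)).re ≤ (c.bhi : ℝ)) :
    Bracket F a b c.lo hi :=
  ⟨lowerRow_of_momentCheck hF hG hβ hc hψ hnlo hnhi halo hahi hbhi,
    upperRow_of_momentEnclosure hF hψ ((TempleMoments.Cert.check_eq_true_iff c).1 hc).1 hnlo hnhi hahi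
      hside⟩

/-- The bracket under the strong certificate `GapCertificateCodimOne`. [cite: WeinsteinStenger1972, Ch. 5 §9 eq. (2), p. 104] -/
theorem bracket_of_momentCheck_codimOne {F : Model k} (hF : F.IsSymmetric) {a b : ℕ} {β : ℚ}
    (hG : GapCertificateCodimOne F a b β) {c : TempleMoments.Cert} (hβ : c.beta ≤ β)
    (hc : c.check = true) {hi : ℚ} (hside : c.ahi ≤ min ((hi - c.rho) * c.nlo) ((hi - c.rho) * c.nhi))
    {ψ : Fock (Orb (Fin k))} (hψ : IsInSector a b ψ)
    (hnlo : (c.nlo : ℝ) ≤ (star ψ ⬝ᵥ ψ).re) (hnhi : (star ψ ⬝ᵥ ψ).re ≤ (c.nhi : ℝ))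
    (halo : (c.alo : ℝ) ≤ (star ψ ⬝ᵥ (F.hamiltonian *ᵥ ψ - ((c.rho : ℝ) : ℂ) • ψ)).re)
    (hahi : (star ψ ⬝ᵥ (F.hamiltonian *ᵥ ψ - ((c.rho : ℝ) : ℂ) • ψ)).re ≤ (c.ahi : ℝ))
    (hbhi : (star (F.hamiltonian *ᵥ ψ - ((c.rho : ℝ) : ℂ) • ψ) ⬝ᵥ
      (F.hamiltonian *ᵥ ψ - ((c.rho : ℝ) : ℂ) • ψ)).re ≤ (c.bhi : ℝ)) :
    Bracket F a b c.lo hi :=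
  bracket_of_momentCheck hF (hG.gapCertificate hF) hβ hc hside hψ hnlo hnhi halo hahi hbhi

end Summit.Ventures.CertifiedQuantumChemistry

end
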